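import Summits.QuantumFields.YangMills.Theorems.BalabanUVNodesN15KingModelDressedJetNoFit
import Summits.QuantumFields.YangMills.Theorems.BalabanUVNodesN15KingModelConstraintLetters
import HarnessLib

/-!
# N15 (NE2) — PROGRAMME K, part K-D: ★★★ THE COVARIANT-LAPLACIAN ENTRY OF THE FIRST-ORDER DRESSED KING JET — `𝔇(N′²Δ′_{V′}X′, N²Δ_{V̄}X̄)`, `N²Δ_V X := (N²Δ ⊗ 1)X + VX` — HAS AN η-RATE
# UNDER THE (3.35) PAIR ALONE, HYPOTHESIS-FREE (dag-n15-d g21's constraint-term mechanism + K-B's jet defect; no letter on `∇c′`, no fit of `c′`)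

WHO ∕ WHEN.  Cell `pub-ymgap`, seat `pub-ymgap-dag-n15-a` (KNIT-BY-NAME seat of Track-A DAG node N15 = NE2, g25); `--kind proof --supports stmt-QuantumFields-27366 --as helper` (K3⁸;
count-neutral).  THEOREMS ONLY (0 `def`).  «K-D (go)» (INBOX I.≈42560, dag-n15-d g21 ARCHITECTURE NOTE I.42548).  Over K-B `…KingModelDressedJetNoFit` (★★★ `hasMaj_idef_bgPair_kingJet`, ★★
`hasMaj_projO_idef_bgPair_kingJet`), K-A `…KingModelJetLettersColour` (★ `kingJet_uniform_letters`), dag-n15-d g21 FILES 61–63 `…KingModelConstraint{Term,CellOscillation,Letters}`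
(`tensorId_constraint_eq`, ★★ `hasMaj_kingQOp_comp_idef_mulOp_blockAvg`, ★ `kingQOp_uniform_letters`, `hasMaj_smul_ofBlocks`), III-B∕III-C (`idef_unstack_eq`), n15-b B1∕B1b (`isUnit_stepV`,
`hasMaj_bgPropV`, `hasMaj_V_bgPropV`, `hasMaj_stack`, `hasMaj_unstack`, `hasMaj_projO_comp`, `abs_blockAvg_le`, `projO_none_bgPair`, `bgPair`), II-B (`hasMaj_comp_diagK_const`, `diagK_const_mono`),
`T4EtaRateCoeffDefect.hasMaj_idef_mulOp`, `T4EtaRateDefect.idef_comp∕add∕sub∕smul`, `B11SectG.hasMaj_comp_exp`, `B6UnitTorusCarrier.rowSum_unitTorusGeo` BY NAME; nothing in the tree is modified.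

WHY (n15-d g21).  [B9] (3.42)₃ prints the COVARIANT Laplacian `Δ_U G(U)`.  In the first-order model (`X = A₀⁻¹(1 + VX)`, `A₀ = N²(−Δ) + m² + a_KQ*Q`, `V = M_c + Σ_μ M_{a_μ}N∇_μ`) the model's
covariant Laplacian of the dressed propagator is `N²Δ_V X := (N²ΔA₀⁻¹ ⊗ 1)(1 + VX) + VX` and satisfies EXACTLY `N²Δ_V X = m²X + T(1 + VX) − 1`, `T = a_KQ*QA₀⁻¹ ⊗ 1` (the constraint term); hence
`𝔇(N′²Δ′_{V′}X′, N²Δ_{V̄}X̄) = m²𝔇₀ + 𝔇(T′, T̄)∘(1 + V̂X̂) + T′∘(V̂′∘𝔇ĥ + 𝔇(V̂′, V̂)∘X̂)` — every term (3.35)-rated: `𝔇₀` and the jet defect `𝔇ĥ` are K-B, `𝔇(T′, T̄)` is n15-d FILE 63, and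
the sandwiched coefficient defect `T′∘𝔇(V̂′, V̂)` splits into n15-d's ★★ cell-oscillation row of `T` (front `T′`, `c′`-part, `(K+2)L^{−K}`) and the diagonal fit rows of `a′`.  The FLAT entry
`N′²Δ′X′` is NOT rated under `coeffBgFO` (naked `(c′ − c̄∘π)·X̄λ`), and is not typed.

WHAT.  §13 `idef_covLapJet_eq` (generic carriers: the identity above from `T = 1 + Lp − m²G` and the (3.65) fixed point).  §14 ★★★ `hasMaj_idef_covLapJet_king (hd : 1 ≤ d) (hLodd) (hL : 2 ≤ L) (ha)
(hm0) (hγ0 : 0 ≤ γ) (hγ1 : γ < 1) : ∃ δ r₀ B > 0, ∀ K ≥ 1, n ≥ 1, e, M = 2L^e, 0 < m² ≤ m₀², r ≤ r₀, o_a ≥ 0, (c′, a′) with |c′|, |a′| ≤ r and fit of a′ ≤ o_a: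
HasMaj (ofBlocks (unitTorusGeo L K M) (blkFine L K M)) (ofBlocks … (blockOf (L^n·L^K) M ∘ fst)) (𝔇_{kingPrV}((N′²Δ′A₀′⁻¹ ⊗ 1)∘(1 + V̂′X̂′) + V̂′X̂′, (N²ΔA₀⁻¹ ⊗ 1)∘(1 + V̂X̂) + V̂X̂))
(B((L^K)^{−γ∕2} + r(K+2)∕L^K + o_a)e^{−δd})` — HYPOTHESIS-FREE.
HONEST FRAMING ∕ LIMITS.  Count-neutral assembly of LANDED rows; King's `A = 0` MODEL on finite tori (template literature [King1986]), NOT Bałaban's `G(U)`; abelianised scalar-multiplier model of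
(3.52)'s `V′(A)`, block-averaged coarse partner (C3); letters on `(c′, a′)` = sups + ONE fit of `a′`; the dressed DIVERGENCE entry stays located (n15-d g18∕g21: the pure second source difference
of `A₀′⁻¹` summed over cells); NE2⁺ NOT printed ∕ NOT proved; no statement of record touched; N15 NOT discharged; K3⁸ OPEN; counts UNMOVED (typed 28∕28 · discharged 5∕27); one finite torus per
index — NOT ℝ⁴ ∕ infinite volume ∕ OS ∕ mass gap ∕ Clay.  ONE declared `set_option maxHeartbeats 800000 in` on ★★★ (four-term block-majorant assembly over long operator terms).
-/

noncomputable section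

open scoped BigOperators
open Finset

namespace Summit.QuantumFields.YangMills.BalabanUVNodes.N15.TwoGrid.KingJet

open Literature.MathematicalPhysics.QuantumFieldTheory.Balaban1983to89
open Literature.MathematicalPhysics.QuantumFieldTheory.Balaban1983to89.B11SectG (BlockNorm HasMaj hasMaj_comp hasMaj_comp_exp RowSum)
open Literature.MathematicalPhysics.QuantumFieldTheory.Balaban1983to89.T4EtaRateDefect (idef idef_apply idef_comp idef_add idef_sub idef_smul)
open Literature.MathematicalPhysics.QuantumFieldTheory.Balaban1983to89.T4EtaRateCoeffDefect (pull pull_apply diagK blockAvg hasMaj_idef_mulOp)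
open Literature.MathematicalPhysics.QuantumFieldTheory.Balaban1983to89.B6RandomWalk (Triangle254)
open Literature.MathematicalPhysics.QuantumFieldTheory.Balaban1983to89.B6Prop26Gluing (mulOp mulOp_apply)
open Literature.MathematicalPhysics.QuantumFieldTheory.Balaban1983to89.B5Prop11Plancherel (Tor fine unitVec)
open Literature.MathematicalPhysics.QuantumFieldTheory.King1986 (aK)
open Literature.MathematicalPhysics.QuantumFieldTheory.King1986.Torus (blockOf blockProj tdistT tdistT_nonneg)
open Literature.MathematicalPhysics.QuantumFieldTheory.Balaban1983to89.B6UnitTorusCarrier (unitTorusGeo triangle254_unitTorusGeo rowSum_unitTorusGeo)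
open Summit.QuantumFields.YangMills.BalabanUVNodes.N15.VectorPiece (kingPrV blkFine blkFine_comp_kingPrV tensorId)
open Summit.QuantumFields.YangMills.BalabanUVNodes.N15.BackgroundModel (kappa_ofBlocks)
open Summit.QuantumFields.YangMills.BalabanUVNodes.N15KingModelRung.Curved (kingGOp kingLapOp)
open Summit.QuantumFields.YangMills.BalabanUVNodes.N15.KingModel.Constraint (tensorId_constraint_eq hasMaj_kingQOp_comp_idef_mulOp_blockAvg kingQOp_uniform_letters)
open Summit.QuantumFields.YangMills.BalabanUVNodes.N15.BackgroundLayer (bgPropV bgPropV_fix isUnit_stepV hasMaj_bgPropV hasMaj_V_bgPropV stack unstack projO liftPair blkPair bgPair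
  hasMaj_stack hasMaj_unstack hasMaj_projO_comp abs_blockAvg_le projO_none_bgPair)

variable {d : ℕ}

/-! ## §13 The covariant-Laplacian entry: the operator identity -/

section Identity

variable {X X' J : Type} [Fintype X] [Fintype X'] [Fintype J] [DecidableEq X] [DecidableEq X'] [DecidableEq J] (π : X' → X)

/-- **`𝔇(N′²Δ′_{V′}X′, N²Δ_{V̄}X̄) = m²𝔇₀ + 𝔇(T′, T̄)∘(1 + V̂X̂) + T′∘(V̂′∘𝔇ĥ + 𝔇(V̂′, V̂)∘X̂)`** (generic carriers): for pieces `G, G′` with constraint terms `T = 1 + Lp − m²G`, `T′ = 1 + Lp′ − m²G′`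
(`Lp` the Laplacian letter) and the (3.65) jets `X̂ = bgPair G D c a`, `X̂′` (both fixed points available), the covariant entries `Lp∘(1 + V̂X̂) + V̂X̂` have the displayed η-defect through
`(pull π, pull π)` — dag-n15-d g21's identity `N²Δ_V X = m²X + T(1 + VX) − 1` differenced. [cite: Balaban1985BackgroundPropagators, (3.42) p.397 (fourth entry: the covariant Laplacian), (3.52) p.400,
(3.65) p.402; King1986, (4.1)–(4.5) p.670, (4.36) p.674 (the constraint term)] -/
theorem idef_covLapJet_eq {Gt Lp T : (X → ℝ) →ₗ[ℝ] (X → ℝ)} {D : J → (X → ℝ) →ₗ[ℝ] (X → ℝ)} {c : X → ℝ} {a : J → X → ℝ}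
    {Gt' Lp' T' : (X' → ℝ) →ₗ[ℝ] (X' → ℝ)} {D' : J → (X' → ℝ) →ₗ[ℝ] (X' → ℝ)} {c' : X' → ℝ} {a' : J → X' → ℝ} {msq : ℝ}
    (hT : T = LinearMap.id + Lp - msq • Gt) (hT' : T' = LinearMap.id + Lp' - msq • Gt')
    (hunit : IsUnit (1 - LinearMap.toMatrix' (stack Gt D ∘ₗ unstack c a))) (hunit' : IsUnit (1 - LinearMap.toMatrix' (stack Gt' D' ∘ₗ unstack c' a'))) :
    idef (pull π) (pull π) (Lp' ∘ₗ (LinearMap.id + unstack c' a' ∘ₗ bgPair Gt' D' c' a') + unstack c' a' ∘ₗ bgPair Gt' D' c' a')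
        (Lp ∘ₗ (LinearMap.id + unstack c a ∘ₗ bgPair Gt D c a) + unstack c a ∘ₗ bgPair Gt D c a)
      = msq • idef (pull π) (pull π) (projO none ∘ₗ bgPair Gt' D' c' a') (projO none ∘ₗ bgPair Gt D c a)
        + idef (pull π) (pull π) T' T ∘ₗ (LinearMap.id + unstack c a ∘ₗ bgPair Gt D c a)
        + T' ∘ₗ (unstack c' a' ∘ₗ idef (pull π) (pull (liftPair (J := J) π)) (bgPair Gt' D' c' a') (bgPair Gt D c a)
            + idef (pull (liftPair (J := J) π)) (pull π) (unstack c' a') (unstack c a) ∘ₗ bgPair Gt D c a) := by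
  have hX := projO_none_bgPair (G := Gt) (D := D) (c := c) (a := a) hunit
  have hX' := projO_none_bgPair (G := Gt') (D := D') (c := c') (a := a') hunit'
  have hLp : Lp = T - LinearMap.id + msq • Gt := by rw [hT]; abel
  have hLp' : Lp' = T' - LinearMap.id + msq • Gt' := by rw [hT']; abel
  refine LinearMap.ext fun f => funext fun x' => ?_
  rw [hLp, hLp']
  simp only [idef_apply, LinearMap.comp_apply, LinearMap.add_apply, LinearMap.sub_apply, LinearMap.smul_apply, LinearMap.id_coe, id_eq, Pi.add_apply,
    Pi.sub_apply, Pi.smul_apply, smul_eq_mul, pull_apply, map_add, map_sub, map_smul, hX, hX']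
  ring

end Identity

/-! ## §14 ★★★ Hypothesis-free on the King rung -/

section King

variable (d) (L : ℕ) [NeZero L]

set_option maxHeartbeats 800000 in
/-- ★★★ **THE COVARIANT-LAPLACIAN ENTRY OF THE FIRST-ORDER DRESSED KING JET HAS AN η-RATE UNDER THE (3.35) PAIR ALONE, HYPOTHESIS-FREE.**  See the module docstring (WHAT).  Constants: K-A's
`(δ₀, β)`, K-B's `(δ_J, r₀^J, B_J)`, dag-n15-d's `(β_T, δ_T)` (FILE 63) and `(C_T, δ_c)` (FILE 62); `ρ = σ := δ_m∕2` of the minimum rate; window `r₀ := min r₀^J (2β(d+2)c_r + 1)⁻¹`.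
[cite: Balaban1985BackgroundPropagators, Thm 3.1 (3.42) p.397 (fourth entry), (3.35) p.396, (3.52) p.400, (3.62)–(3.65) pp.402–403 (mechanism); King1986, (4.1)–(4.5) p.670, (4.36) p.674,
Prop. 3.9 (3.73) p.665 (rate factor), p.664 (pairing)] -/
theorem hasMaj_idef_covLapJet_king (hd : 1 ≤ d) (hLodd : Odd L) (hL : 2 ≤ L) {a : ℝ} (ha : 0 < a) {m0sq : ℝ} (hm0 : 0 ≤ m0sq) {γ : ℝ} (hγ0 : 0 ≤ γ) (hγ1 : γ < 1) :
    ∃ δ r₀ B : ℝ, 0 < δ ∧ 0 < r₀ ∧ 0 < B ∧ ∀ (K : ℕ), 1 ≤ K → ∀ (n : ℕ), 1 ≤ n → ∀ (e : ℕ) (M : Fin (d + 1) → ℕ) [∀ μ, NeZero (M μ)], (∀ μ, M μ = 2 * L ^ e) →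
      ∀ (msq : ℝ), 0 < msq → msq ≤ m0sq → ∀ (r : ℝ), 0 ≤ r → r ≤ r₀ → ∀ (oa : ℝ), 0 ≤ oa →
      ∀ (c' : Tor (fine (L ^ n * L ^ K) M) × Fin (d + 1) → ℝ) (a' : Fin (d + 1) → Tor (fine (L ^ n * L ^ K) M) × Fin (d + 1) → ℝ),
      (∀ z, |c' z| ≤ r) → (∀ μ z, |a' μ z| ≤ r) → (∀ μ z, |a' μ z - blockAvg (kingPrV L K n M) (a' μ) (kingPrV L K n M z)| ≤ oa) →
      HasMaj (BlockNorm.ofBlocks (unitTorusGeo L K M) (blkFine L K M))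
        (BlockNorm.ofBlocks (unitTorusGeo L K M) (fun i : Tor (fine (L ^ n * L ^ K) M) × Fin (d + 1) => blockOf (L ^ n * L ^ K) M i.1))
        (idef (pull (kingPrV L K n M)) (pull (kingPrV L K n M))
          (tensorId (Fin (d + 1)) (kingLapOp L a msq (K + n) (L ^ n * L ^ K) M) ∘ₗ
              (LinearMap.id + unstack c' a' ∘ₗ bgPair (tensorId (Fin (d + 1)) (kingGOp L a msq (K + n) (L ^ n * L ^ K) M))
                (fun μ => symbOp M (L ^ n * L ^ K) (sD M (L ^ n * L ^ K) μ ((L ^ n * L ^ K : ℕ) : ℝ)) ∘ₗ tensorId (Fin (d + 1)) (kingGOp L a msq (K + n) (L ^ n * L ^ K) M)) c' a') +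
            unstack c' a' ∘ₗ bgPair (tensorId (Fin (d + 1)) (kingGOp L a msq (K + n) (L ^ n * L ^ K) M))
              (fun μ => symbOp M (L ^ n * L ^ K) (sD M (L ^ n * L ^ K) μ ((L ^ n * L ^ K : ℕ) : ℝ)) ∘ₗ tensorId (Fin (d + 1)) (kingGOp L a msq (K + n) (L ^ n * L ^ K) M)) c' a')
          (tensorId (Fin (d + 1)) (kingLapOp L a msq K (L ^ K) M) ∘ₗ
              (LinearMap.id + unstack (blockAvg (kingPrV L K n M) c') (fun μ => blockAvg (kingPrV L K n M) (a' μ)) ∘ₗ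
                bgPair (tensorId (Fin (d + 1)) (kingGOp L a msq K (L ^ K) M)) (fun μ => symbOp M (L ^ K) (sD M (L ^ K) μ ((L ^ K : ℕ) : ℝ)) ∘ₗ tensorId (Fin (d + 1)) (kingGOp L a msq K (L ^ K) M))
                  (blockAvg (kingPrV L K n M) c') (fun μ => blockAvg (kingPrV L K n M) (a' μ))) +
            unstack (blockAvg (kingPrV L K n M) c') (fun μ => blockAvg (kingPrV L K n M) (a' μ)) ∘ₗ
              bgPair (tensorId (Fin (d + 1)) (kingGOp L a msq K (L ^ K) M)) (fun μ => symbOp M (L ^ K) (sD M (L ^ K) μ ((L ^ K : ℕ) : ℝ)) ∘ₗ tensorId (Fin (d + 1)) (kingGOp L a msq K (L ^ K) M))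
                (blockAvg (kingPrV L K n M) c') (fun μ => blockAvg (kingPrV L K n M) (a' μ))))
        (fun y y' => B * (((L : ℝ) ^ K) ^ (-(γ / 2)) + r * ((((K : ℕ) : ℝ) + 2) / (L : ℝ) ^ K) + oa) * Real.exp (-(δ * tdistT M y y'))) := by
  -- the letters of record
  obtain ⟨δ₀, β, hδ₀, hβ, HU⟩ := kingJet_uniform_letters d L hd hLodd hL ha hm0 hγ0 hγ1
  obtain ⟨δJ, rJ, BJ, hδJ, hrJ, hBJ, HJ⟩ := hasMaj_idef_bgPair_kingJet d L hd hLodd hL ha hm0 hγ0 hγ1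
  obtain ⟨βT, δT, hβT, hδT, HT⟩ := kingQOp_uniform_letters (d := d) L hLodd hL ha hm0 hγ0 hγ1
  obtain ⟨CT, δc, hCT, hδc, HC⟩ := hasMaj_kingQOp_comp_idef_mulOp_blockAvg (d := d) L hd hLodd hL ha hm0
  -- one rate
  set δm : ℝ := min (min δ₀ δJ) (min δT δc) with hδm_def
  have hδm : 0 < δm := lt_min (lt_min hδ₀ hδJ) (lt_min hδT hδc)
  have e₀ : δm ≤ δ₀ := (min_le_left _ _).trans (min_le_left _ _)
  have eJ : δm ≤ δJ := (min_le_left _ _).trans (min_le_right _ _)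
  have eT : δm ≤ δT := (min_le_right _ _).trans (min_le_left _ _)
  have ec : δm ≤ δc := (min_le_right _ _).trans (min_le_right _ _)
  have hσ : 0 < δm / 2 := by positivity
  set cr : ℝ := B4Sect5Proof.latticeConst (d + 1) (δm / 2) with hcr_def
  have hcr : 0 ≤ cr := B4Sect5Proof.latticeConst_nonneg (d + 1) hσ.le
  set W : ℝ := β * ((d : ℝ) + 2) * cr with hW_def
  have hW : 0 ≤ W := by positivity
  have hr₀' : 0 < (2 * W + 1)⁻¹ := by positivity
  set r₀ : ℝ := min rJ (2 * W + 1)⁻¹ with hr₀_def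
  have hr₀ : 0 < r₀ := lt_min hrJ hr₀'
  -- the total constant
  set B : ℝ := m0sq * BJ + βT + βT * (((d : ℝ) + 2) * (2 * β)) * cr + βT * ((d : ℝ) + 2) * BJ * cr + (CT + ((d : ℝ) + 1) * βT) * (2 * β) * cr + 1 with hB_def
  have hB : 0 < B := by positivity
  refine ⟨δm / 2, r₀, B, hσ, hr₀, hB, ?_⟩
  intro K hK n hn e M _ hM msq hmsq hcap r hr hrr₀ oa hoa c' a' hc' ha' hfa
  have hrrJ : r ≤ rJ := hrr₀.trans (min_le_left _ _)
  have hrrW : r ≤ (2 * W + 1)⁻¹ := hrr₀.trans (min_le_right _ _)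
  -- geometry
  have htri : Triangle254 (unitTorusGeo L K M) := triangle254_unitTorusGeo L K M
  have hdd : ∀ a b : (unitTorusGeo L K M).Site, 0 ≤ (unitTorusGeo L K M).dist a b := fun a b => tdistT_nonneg M a b
  have hrow := rowSum_unitTorusGeo L K M hσ
  have hρδ : δm / 2 + δm / 2 ≤ δm := by linarith
  have hLr : (0 : ℝ) < (L : ℝ) := by exact_mod_cast (show 0 < L by omega)
  have hθ : 0 ≤ ((L : ℝ) ^ K) ^ (-(γ / 2)) := Real.rpow_nonneg (pow_nonneg hLr.le _) _
  have ht : 0 ≤ r * ((((K : ℕ) : ℝ) + 2) / (L : ℝ) ^ K) := mul_nonneg hr (div_nonneg (by positivity) (pow_nonneg hLr.le _))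
  set S : ℝ := ((L : ℝ) ^ K) ^ (-(γ / 2)) + r * ((((K : ℕ) : ℝ) + 2) / (L : ℝ) ^ K) + oa with hS_def
  have hS : 0 ≤ S := by positivity
  have hmono : ∀ {F₁ F₂ : Type} [AddCommGroup F₁] [Module ℝ F₁] [AddCommGroup F₂] [Module ℝ F₂]
      {b₁ : BlockNorm (unitTorusGeo L K M) F₁} {b₂ : BlockNorm (unitTorusGeo L K M) F₂} {Tm : F₁ →ₗ[ℝ] F₂} {A A' tt : ℝ},
      0 ≤ A → A ≤ A' → δm ≤ tt → HasMaj b₁ b₂ Tm (fun y y' => A * Real.exp (-(tt * tdistT M y y'))) →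
      HasMaj b₁ b₂ Tm (fun y y' => A' * Real.exp (-(δm * tdistT M y y'))) :=
    fun hA hAA' htt h => h.mono fun y y' => mul_le_mul hAA' (Real.exp_le_exp.mpr (by nlinarith [tdistT_nonneg M y y'])) (Real.exp_nonneg _) (hA.trans hAA')
  -- names
  set Gc := tensorId (Fin (d + 1)) (kingGOp L a msq K (L ^ K) M) with hGc_def
  set Gf := tensorId (Fin (d + 1)) (kingGOp L a msq (K + n) (L ^ n * L ^ K) M) with hGf_def
  set Dc : Fin (d + 1) → (Tor (fine (L ^ K) M) × Fin (d + 1) → ℝ) →ₗ[ℝ] (Tor (fine (L ^ K) M) × Fin (d + 1) → ℝ) :=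
    fun μ => symbOp M (L ^ K) (sD M (L ^ K) μ ((L ^ K : ℕ) : ℝ)) ∘ₗ Gc with hDc
  set Df : Fin (d + 1) → (Tor (fine (L ^ n * L ^ K) M) × Fin (d + 1) → ℝ) →ₗ[ℝ] (Tor (fine (L ^ n * L ^ K) M) × Fin (d + 1) → ℝ) :=
    fun μ => symbOp M (L ^ n * L ^ K) (sD M (L ^ n * L ^ K) μ ((L ^ n * L ^ K : ℕ) : ℝ)) ∘ₗ Gf with hDf
  set c : Tor (fine (L ^ K) M) × Fin (d + 1) → ℝ := blockAvg (kingPrV L K n M) c' with hc_def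
  set av : Fin (d + 1) → Tor (fine (L ^ K) M) × Fin (d + 1) → ℝ := fun μ => blockAvg (kingPrV L K n M) (a' μ) with hav_def
  have hc : ∀ x, |c x| ≤ r := abs_blockAvg_le (kingPrV L K n M) hr hc'
  have hav : ∀ μ x, |av μ x| ≤ r := fun μ => abs_blockAvg_le (kingPrV L K n M) hr (ha' μ)
  have hblk : blkFine L K M ∘ kingPrV L K n M = fun i : Tor (fine (L ^ n * L ^ K) M) × Fin (d + 1) => blockOf (L ^ n * L ^ K) M i.1 := blkFine_comp_kingPrV M L K n
  set b₁ := BlockNorm.ofBlocks (unitTorusGeo L K M) (blkFine L K M) with hb₁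
  set bf := BlockNorm.ofBlocks (unitTorusGeo L K M) (fun i : Tor (fine (L ^ n * L ^ K) M) × Fin (d + 1) => blockOf (L ^ n * L ^ K) M i.1) with hbf
  -- (1) the letters at the common rate
  obtain ⟨hG, hGD, hG', hG'D, -, -, -⟩ := HU K hK n hn e M hM msq hmsq hcap
  have hG₁ := hmono hβ.le le_rfl e₀ hG
  have hGD₁ := fun μ => hmono hβ.le le_rfl e₀ (hGD μ)
  have hG'₁ := hmono hβ.le le_rfl e₀ hG'
  have hG'D₁ := fun μ => hmono hβ.le le_rfl e₀ (hG'D μ)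
  obtain ⟨-, hT', hDT⟩ := HT K hK n hn e M hM msq hmsq hcap
  have hT'₁ := hmono hβT.le le_rfl eT hT'
  have hDT₁ := hmono (mul_nonneg hβT.le hθ) le_rfl eT hDT
  have hTc₁ := hmono (mul_nonneg (mul_nonneg hCT.le hr) (div_nonneg (by positivity) (pow_nonneg hLr.le _))) le_rfl ec (HC K hK n e M hM msq hmsq hcap c' r hr hc')
  -- (2) the sup jets: existence (fixed points) and the coarse jet's rows
  have hR : r * (1 + (Fintype.card (Fin (d + 1)) : ℝ)) ≤ r * (d + 2) := by rw [Fintype.card_fin]; push_cast; exact le_of_eq (by ring)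
  have hRd : (0 : ℝ) ≤ r * (d + 2) := by positivity
  have hβe : ∀ y y' : Tor M, 0 ≤ β * Real.exp (-(δm * tdistT M y y')) := fun _ _ => mul_nonneg hβ.le (Real.exp_nonneg _)
  have hSG : HasMaj b₁ (BlockNorm.ofBlocks (unitTorusGeo L K M) (blkPair (blkFine L K M))) (stack Gc Dc) (fun y y' => β * Real.exp (-(δm * tdistT M y y'))) :=
    hasMaj_stack (g := unitTorusGeo L K M) (blkFine L K M) hβe hG₁ hGD₁
  have hSG' : HasMaj bf (BlockNorm.ofBlocks (unitTorusGeo L K M) (blkPair (J := Fin (d + 1)) fun i : Tor (fine (L ^ n * L ^ K) M) × Fin (d + 1) => blockOf (L ^ n * L ^ K) M i.1))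
      (stack Gf Df) (fun y y' => β * Real.exp (-(δm * tdistT M y y'))) :=
    hasMaj_stack (g := unitTorusGeo L K M) _ hβe hG'₁ hG'D₁
  have hV := (hasMaj_unstack (g := unitTorusGeo L K M) (blkFine L K M) hr hc hav).mono fun y y' => diagK_const_mono hR y y'
  have hV' := (hasMaj_unstack (g := unitTorusGeo L K M) (fun i : Tor (fine (L ^ n * L ^ K) M) × Fin (d + 1) => blockOf (L ^ n * L ^ K) M i.1) hr hc' ha').mono
    fun y y' => diagK_const_mono hR y y'
  have h1 : (2 * W + 1)⁻¹ * (2 * W + 1) = 1 := inv_mul_cancel₀ (by positivity)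
  have hq : β * (r * ((d : ℝ) + 2)) * cr < 1 := by
    have hle : β * (r * ((d : ℝ) + 2)) * cr ≤ (2 * W + 1)⁻¹ * W := by
      calc β * (r * ((d : ℝ) + 2)) * cr = r * (β * ((d : ℝ) + 2) * cr) := by ring
        _ ≤ (2 * W + 1)⁻¹ * (β * ((d : ℝ) + 2) * cr) := mul_le_mul_of_nonneg_right hrrW (by positivity)
        _ = (2 * W + 1)⁻¹ * W := by rw [hW_def]
    nlinarith [hr₀'.le]
  have hq0 : 0 < 1 - β * (r * ((d : ℝ) + 2)) * cr := by linarith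
  have hunit := isUnit_stepV (blkFine L K M) (blkPair (blkFine L K M)) hdd hrow (by linarith) hβ.le hRd hSG hV hq
  have hunit' := isUnit_stepV (fun i : Tor (fine (L ^ n * L ^ K) M) × Fin (d + 1) => blockOf (L ^ n * L ^ K) M i.1)
    (blkPair (J := Fin (d + 1)) fun i : Tor (fine (L ^ n * L ^ K) M) × Fin (d + 1) => blockOf (L ^ n * L ^ K) M i.1) hdd hrow (by linarith) hβ.le hRd hSG' hV' hq
  set βX : ℝ := β * (1 - β * (r * ((d : ℝ) + 2)) * cr)⁻¹ with hβX_def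
  have hβX : 0 ≤ βX := mul_nonneg hβ.le (inv_nonneg.2 hq0.le)
  have hq2 : (1 - β * (r * ((d : ℝ) + 2)) * cr)⁻¹ ≤ 2 := by
    have hle : β * (r * ((d : ℝ) + 2)) * cr ≤ 1 / 2 := by
      have : β * (r * ((d : ℝ) + 2)) * cr ≤ (2 * W + 1)⁻¹ * W := by
        calc β * (r * ((d : ℝ) + 2)) * cr = r * (β * ((d : ℝ) + 2) * cr) := by ring
          _ ≤ (2 * W + 1)⁻¹ * (β * ((d : ℝ) + 2) * cr) := mul_le_mul_of_nonneg_right hrrW (by positivity)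
          _ = (2 * W + 1)⁻¹ * W := by rw [hW_def]
      nlinarith [hr₀'.le]
    calc (1 - β * (r * ((d : ℝ) + 2)) * cr)⁻¹ ≤ (1 / 2)⁻¹ := inv_anti₀ (by norm_num) (by linarith)
      _ = 2 := by norm_num
  have hβX2 : βX ≤ 2 * β := by rw [hβX_def]; nlinarith [mul_le_mul_of_nonneg_left hq2 hβ.le]
  have hX := hasMaj_bgPropV (g := unitTorusGeo L K M) (blkFine L K M) (blkPair (blkFine L K M)) htri hdd hrow hσ.le hσ.le hρδ hβ.le hRd hSG hV hq
  have hXv : HasMaj b₁ b₁ (projO none ∘ₗ bgPair Gc Dc c av) (fun y y' => βX * Real.exp (-(δm / 2 * tdistT M y y'))) :=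
    hasMaj_projO_comp (g := unitTorusGeo L K M) (blkFine L K M) hX none
  have hYb : ∀ μ, HasMaj b₁ b₁ (projO (some μ) ∘ₗ bgPair Gc Dc c av) (fun y y' => βX * Real.exp (-(δm / 2 * tdistT M y y'))) := fun μ =>
    hasMaj_projO_comp (g := unitTorusGeo L K M) (blkFine L K M) hX (some μ)
  have hVX : HasMaj b₁ b₁ (unstack c av ∘ₗ bgPair Gc Dc c av) (fun y y' => r * (d + 2) * βX * Real.exp (-(δm / 2 * tdistT M y y'))) :=
    hasMaj_V_bgPropV (g := unitTorusGeo L K M) (blkFine L K M) (blkPair (blkFine L K M)) htri hdd hrow hσ.le hσ.le hρδ hβ.le hRd hSG hV hq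
  -- (3) the four terms of the identity
  -- T1: `m²·𝔇₀`
  have hJ0 := hasMaj_projO_idef_bgPair M K n (HJ K hK n hn e M hM msq hmsq hcap r hr hrrJ oa hoa c' a' hc' ha' hfa) none
  have hT1 : HasMaj b₁ bf (msq • idef (pull (kingPrV L K n M)) (pull (kingPrV L K n M)) (projO none ∘ₗ bgPair Gf Df c' a') (projO none ∘ₗ bgPair Gc Dc c av))
      (fun y y' => m0sq * BJ * S * Real.exp (-(δm / 2 * tdistT M y y'))) := by
    have h0 := hmono (A := BJ * S) (A' := BJ * S) (by positivity) le_rfl eJ hJ0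
    have h := hasMaj_smul_ofBlocks (g := unitTorusGeo L K M) (b₁ := b₁) (fun i : Tor (fine (L ^ n * L ^ K) M) × Fin (d + 1) => blockOf (L ^ n * L ^ K) M i.1)
      (fun y y' => mul_nonneg (mul_nonneg hBJ.le hS) (Real.exp_nonneg _)) msq h0
    refine h.mono fun y y' => ?_
    rw [abs_of_pos hmsq]
    have hE : Real.exp (-(δm * tdistT M y y')) ≤ Real.exp (-(δm / 2 * tdistT M y y')) := Real.exp_le_exp.mpr (by nlinarith [tdistT_nonneg M y y', hδm])
    calc msq * (BJ * S * Real.exp (-(δm * tdistT M y y'))) ≤ m0sq * (BJ * S * Real.exp (-(δm / 2 * tdistT M y y'))) :=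
          mul_le_mul hcap (mul_le_mul_of_nonneg_left hE (mul_nonneg hBJ.le hS)) (by positivity) hm0
      _ = m0sq * BJ * S * Real.exp (-(δm / 2 * tdistT M y y')) := by ring
  -- T2: `𝔇(T′,T̄)∘(1 + V̂X̂)`
  have hT2 : HasMaj b₁ bf (idef (pull (kingPrV L K n M)) (pull (kingPrV L K n M))
        (tensorId (Fin (d + 1)) (aK a L (K + n) • (Matrix.mulVecLin (blockProj (L ^ n * L ^ K) M) ∘ₗ kingGOp L a msq (K + n) (L ^ n * L ^ K) M)))
        (tensorId (Fin (d + 1)) (aK a L K • (Matrix.mulVecLin (blockProj (L ^ K) M) ∘ₗ kingGOp L a msq K (L ^ K) M))) ∘ₗ (LinearMap.id + unstack c av ∘ₗ bgPair Gc Dc c av))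
      (fun y y' => (βT + βT * (((d : ℝ) + 2) * (2 * β)) * cr) * S * Real.exp (-(δm / 2 * tdistT M y y'))) := by
    rw [LinearMap.comp_add, LinearMap.comp_id]
    have e1 : HasMaj b₁ bf (idef (pull (kingPrV L K n M)) (pull (kingPrV L K n M))
        (tensorId (Fin (d + 1)) (aK a L (K + n) • (Matrix.mulVecLin (blockProj (L ^ n * L ^ K) M) ∘ₗ kingGOp L a msq (K + n) (L ^ n * L ^ K) M)))
        (tensorId (Fin (d + 1)) (aK a L K • (Matrix.mulVecLin (blockProj (L ^ K) M) ∘ₗ kingGOp L a msq K (L ^ K) M))))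
        (fun y y' => βT * ((L : ℝ) ^ K) ^ (-(γ / 2)) * Real.exp (-(δm / 2 * tdistT M y y'))) :=
      hDT₁.mono fun y y' => mul_le_mul_of_nonneg_left (Real.exp_le_exp.mpr (by nlinarith [tdistT_nonneg M y y', hδm])) (mul_nonneg hβT.le hθ)
    have e2 := hasMaj_comp_exp (b₁ := b₁) (b₂ := b₁) (b₃ := bf) htri hdd hrow (mul_nonneg hβT.le hθ) (by positivity : 0 ≤ r * (d + 2) * βX) hσ.le le_rfl hρδ hDT₁ hVX
    refine (e1.add e2).mono fun y y' => ?_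
    have hE := Real.exp_nonneg (-(δm / 2 * tdistT M y y'))
    rw [hb₁, kappa_ofBlocks]
    have hθS : ((L : ℝ) ^ K) ^ (-(γ / 2)) ≤ S := by rw [hS_def]; linarith
    have h2 : r * (d + 2) * βX * cr ≤ ((d : ℝ) + 2) * (2 * β) * cr := by
      have hr1 : r ≤ 1 := by
        have : (2 * W + 1)⁻¹ ≤ 1 := inv_le_one_of_one_le₀ (by linarith)
        linarith
      calc r * (d + 2) * βX * cr ≤ 1 * (d + 2) * (2 * β) * cr := by
            exact mul_le_mul_of_nonneg_right (mul_le_mul (mul_le_mul_of_nonneg_right hr1 (by positivity)) hβX2 hβX (by positivity)) hcr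
        _ = ((d : ℝ) + 2) * (2 * β) * cr := by ring
    show βT * ((L : ℝ) ^ K) ^ (-(γ / 2)) * Real.exp (-(δm / 2 * tdistT M y y')) +
        1 * (βT * ((L : ℝ) ^ K) ^ (-(γ / 2))) * (r * (d + 2) * βX) * cr * Real.exp (-(δm / 2 * (unitTorusGeo L K M).dist y y'))
      ≤ (βT + βT * (((d : ℝ) + 2) * (2 * β)) * cr) * S * Real.exp (-(δm / 2 * tdistT M y y'))
    have hdist : (unitTorusGeo L K M).dist y y' = tdistT M y y' := rfl
    rw [hdist]
    calc βT * ((L : ℝ) ^ K) ^ (-(γ / 2)) * Real.exp (-(δm / 2 * tdistT M y y')) + 1 * (βT * ((L : ℝ) ^ K) ^ (-(γ / 2))) * (r * (d + 2) * βX) * cr * Real.exp (-(δm / 2 * tdistT M y y'))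
        = βT * ((L : ℝ) ^ K) ^ (-(γ / 2)) * (1 + r * (d + 2) * βX * cr) * Real.exp (-(δm / 2 * tdistT M y y')) := by ring
      _ ≤ βT * S * (1 + ((d : ℝ) + 2) * (2 * β) * cr) * Real.exp (-(δm / 2 * tdistT M y y')) :=
          mul_le_mul_of_nonneg_right (mul_le_mul (mul_le_mul_of_nonneg_left hθS hβT.le) (by linarith) (by positivity) (by positivity)) hE
      _ = (βT + βT * (((d : ℝ) + 2) * (2 * β)) * cr) * S * Real.exp (-(δm / 2 * tdistT M y y')) := by ring
  -- T3: `T′∘V̂′∘𝔇ĥ`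
  have hTV : HasMaj (BlockNorm.ofBlocks (unitTorusGeo L K M) (blkPair (J := Fin (d + 1)) fun i : Tor (fine (L ^ n * L ^ K) M) × Fin (d + 1) => blockOf (L ^ n * L ^ K) M i.1)) bf
      (tensorId (Fin (d + 1)) (aK a L (K + n) • (Matrix.mulVecLin (blockProj (L ^ n * L ^ K) M) ∘ₗ kingGOp L a msq (K + n) (L ^ n * L ^ K) M)) ∘ₗ unstack c' a')
      (fun y y' => βT * (r * (d + 2)) * Real.exp (-(δm * tdistT M y y'))) :=
    hasMaj_comp_diagK_const (g := unitTorusGeo L K M) _ _ hβT.le hT'₁ hV'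
  have hJst := hmono (A := BJ * S) (A' := BJ * S) (by positivity) le_rfl eJ (HJ K hK n hn e M hM msq hmsq hcap r hr hrrJ oa hoa c' a' hc' ha' hfa)
  have hT3 : HasMaj b₁ bf ((tensorId (Fin (d + 1)) (aK a L (K + n) • (Matrix.mulVecLin (blockProj (L ^ n * L ^ K) M) ∘ₗ kingGOp L a msq (K + n) (L ^ n * L ^ K) M)) ∘ₗ unstack c' a') ∘ₗ
        idef (pull (kingPrV L K n M)) (pull (liftPair (J := Fin (d + 1)) (kingPrV L K n M))) (bgPair Gf Df c' a') (bgPair Gc Dc c av))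
      (fun y y' => βT * ((d : ℝ) + 2) * BJ * cr * S * Real.exp (-(δm / 2 * tdistT M y y'))) := by
    have e := hasMaj_comp_exp (b₁ := b₁) (b₂ := BlockNorm.ofBlocks (unitTorusGeo L K M) (blkPair (J := Fin (d + 1)) fun i : Tor (fine (L ^ n * L ^ K) M) × Fin (d + 1) => blockOf (L ^ n * L ^ K) M i.1))
      (b₃ := bf) htri hdd hrow (by positivity : 0 ≤ βT * (r * (d + 2))) (by positivity : 0 ≤ BJ * S) hσ.le (by linarith) hρδ hTV hJst
    refine e.mono fun y y' => ?_
    rw [kappa_ofBlocks]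
    have hE := Real.exp_nonneg (-(δm / 2 * tdistT M y y'))
    have hr1 : r ≤ 1 := by
      have : (2 * W + 1)⁻¹ ≤ 1 := inv_le_one_of_one_le₀ (by linarith)
      linarith
    calc 1 * (βT * (r * (d + 2))) * (BJ * S) * cr * Real.exp (-(δm / 2 * tdistT M y y'))
        = r * (βT * ((d : ℝ) + 2) * BJ * cr * S) * Real.exp (-(δm / 2 * tdistT M y y')) := by ring
      _ ≤ 1 * (βT * ((d : ℝ) + 2) * BJ * cr * S) * Real.exp (-(δm / 2 * tdistT M y y')) :=
          mul_le_mul_of_nonneg_right (mul_le_mul_of_nonneg_right hr1 (by positivity)) hE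
      _ = βT * ((d : ℝ) + 2) * BJ * cr * S * Real.exp (-(δm / 2 * tdistT M y y')) := by ring
  -- T4: `T′∘𝔇(V̂′,V̂)∘X̂` = `(T′∘𝔇(M_{c′},M_c̄))∘X₀ + Σ_μ (T′∘𝔇(M_{a′_μ},M_{ā_μ}))∘Y_μ`
  have hfit : ∀ μ, HasMaj b₁ bf (idef (pull (kingPrV L K n M)) (pull (kingPrV L K n M)) (mulOp (a' μ)) (mulOp (av μ))) (diagK fun _ => oa) := by
    intro μ
    have h := hasMaj_idef_mulOp (g := unitTorusGeo L K M) (blkFine L K M) (kingPrV L K n M) (a' := a' μ) (a := av μ) (o := fun _ => oa) (fun _ => hoa) fun z => hfa μ z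
    rw [hblk] at h
    exact h
  have haT : ∀ μ, HasMaj b₁ bf (tensorId (Fin (d + 1)) (aK a L (K + n) • (Matrix.mulVecLin (blockProj (L ^ n * L ^ K) M) ∘ₗ kingGOp L a msq (K + n) (L ^ n * L ^ K) M)) ∘ₗ
        idef (pull (kingPrV L K n M)) (pull (kingPrV L K n M)) (mulOp (a' μ)) (mulOp (av μ))) (fun y y' => βT * oa * Real.exp (-(δm * tdistT M y y'))) := fun μ =>
    hasMaj_comp_diagK_const (g := unitTorusGeo L K M) _ (blkFine L K M) hβT.le hT'₁ (hfit μ)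
  set Wop := idef (pull (kingPrV L K n M)) (pull (kingPrV L K n M)) (mulOp c') (mulOp c) ∘ₗ (projO none ∘ₗ bgPair Gc Dc c av) +
      ∑ μ, idef (pull (kingPrV L K n M)) (pull (kingPrV L K n M)) (mulOp (a' μ)) (mulOp (av μ)) ∘ₗ (projO (some μ) ∘ₗ bgPair Gc Dc c av) with hWop_def
  have hWeq : idef (pull (liftPair (J := Fin (d + 1)) (kingPrV L K n M))) (pull (kingPrV L K n M)) (unstack c' a') (unstack c av) ∘ₗ bgPair Gc Dc c av = Wop := by
    rw [hWop_def, idef_unstack_eq]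
    refine LinearMap.ext fun f => ?_
    simp only [LinearMap.comp_apply, LinearMap.add_apply, LinearMap.sum_apply]
  have hT4 : HasMaj b₁ bf (tensorId (Fin (d + 1)) (aK a L (K + n) • (Matrix.mulVecLin (blockProj (L ^ n * L ^ K) M) ∘ₗ kingGOp L a msq (K + n) (L ^ n * L ^ K) M)) ∘ₗ Wop)
      (fun y y' => (CT + ((d : ℝ) + 1) * βT) * (2 * β) * cr * S * Real.exp (-(δm / 2 * tdistT M y y'))) := by
    have e1 := hasMaj_comp_exp (b₁ := b₁) (b₂ := b₁) (b₃ := bf) htri hdd hrow (mul_nonneg (mul_nonneg hCT.le hr) (div_nonneg (by positivity) (pow_nonneg hLr.le _))) hβX hσ.le le_rfl hρδ hTc₁ hXv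
    have e2 := hasMaj_finsum (b₁ := b₁) (b₂ := bf) Finset.univ
      (fun μ => (tensorId (Fin (d + 1)) (aK a L (K + n) • (Matrix.mulVecLin (blockProj (L ^ n * L ^ K) M) ∘ₗ kingGOp L a msq (K + n) (L ^ n * L ^ K) M)) ∘ₗ
        idef (pull (kingPrV L K n M)) (pull (kingPrV L K n M)) (mulOp (a' μ)) (mulOp (av μ))) ∘ₗ (projO (some μ) ∘ₗ bgPair Gc Dc c av))
      (fun _ y y' => b₁.κ * (βT * oa) * βX * cr * Real.exp (-(δm / 2 * tdistT M y y')))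
      fun μ _ => hasMaj_comp_exp (b₁ := b₁) (b₂ := b₁) (b₃ := bf) htri hdd hrow (mul_nonneg hβT.le hoa) hβX hσ.le le_rfl hρδ (haT μ) (hYb μ)
    have hop : tensorId (Fin (d + 1)) (aK a L (K + n) • (Matrix.mulVecLin (blockProj (L ^ n * L ^ K) M) ∘ₗ kingGOp L a msq (K + n) (L ^ n * L ^ K) M)) ∘ₗ Wop =
        (tensorId (Fin (d + 1)) (aK a L (K + n) • (Matrix.mulVecLin (blockProj (L ^ n * L ^ K) M) ∘ₗ kingGOp L a msq (K + n) (L ^ n * L ^ K) M)) ∘ₗ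
            idef (pull (kingPrV L K n M)) (pull (kingPrV L K n M)) (mulOp c') (mulOp c)) ∘ₗ (projO none ∘ₗ bgPair Gc Dc c av) +
          ∑ μ, (tensorId (Fin (d + 1)) (aK a L (K + n) • (Matrix.mulVecLin (blockProj (L ^ n * L ^ K) M) ∘ₗ kingGOp L a msq (K + n) (L ^ n * L ^ K) M)) ∘ₗ
            idef (pull (kingPrV L K n M)) (pull (kingPrV L K n M)) (mulOp (a' μ)) (mulOp (av μ))) ∘ₗ (projO (some μ) ∘ₗ bgPair Gc Dc c av) := by
      rw [hWop_def]
      refine LinearMap.ext fun f => ?_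
      simp only [LinearMap.comp_apply, LinearMap.add_apply, LinearMap.sum_apply, map_add, map_sum]
    rw [hop]
    refine (e1.add e2).mono fun y y' => ?_
    rw [sum_const, card_univ, Fintype.card_fin, nsmul_eq_mul, hb₁, kappa_ofBlocks]
    have hE := Real.exp_nonneg (-(δm / 2 * tdistT M y y'))
    have htS : r * ((((K : ℕ) : ℝ) + 2) / (L : ℝ) ^ K) ≤ S := by rw [hS_def]; linarith
    have hoS : oa ≤ S := by rw [hS_def]; linarith
    push_cast
    have h1 : 1 * (CT * r * ((((K : ℕ) : ℝ) + 2) / (L : ℝ) ^ K)) * βX * cr ≤ CT * (2 * β) * cr * S := by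
      calc 1 * (CT * r * ((((K : ℕ) : ℝ) + 2) / (L : ℝ) ^ K)) * βX * cr = CT * βX * cr * (r * ((((K : ℕ) : ℝ) + 2) / (L : ℝ) ^ K)) := by ring
        _ ≤ CT * (2 * β) * cr * S := mul_le_mul (mul_le_mul_of_nonneg_right (mul_le_mul_of_nonneg_left hβX2 hCT.le) hcr) htS ht (by positivity)
    have h2 : ((d : ℝ) + 1) * (1 * (βT * oa) * βX * cr) ≤ ((d : ℝ) + 1) * βT * (2 * β) * cr * S := by
      calc ((d : ℝ) + 1) * (1 * (βT * oa) * βX * cr) = ((d : ℝ) + 1) * βT * βX * cr * oa := by ring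
        _ ≤ ((d : ℝ) + 1) * βT * (2 * β) * cr * S :=
            mul_le_mul (mul_le_mul_of_nonneg_right (mul_le_mul_of_nonneg_left hβX2 (by positivity)) hcr) hoS hoa (by positivity)
    calc 1 * (CT * r * ((((K : ℕ) : ℝ) + 2) / (L : ℝ) ^ K)) * βX * cr * Real.exp (-(δm / 2 * tdistT M y y')) +
          ((d : ℝ) + 1) * (1 * (βT * oa) * βX * cr * Real.exp (-(δm / 2 * tdistT M y y')))
        = (1 * (CT * r * ((((K : ℕ) : ℝ) + 2) / (L : ℝ) ^ K)) * βX * cr + ((d : ℝ) + 1) * (1 * (βT * oa) * βX * cr)) * Real.exp (-(δm / 2 * tdistT M y y')) := by ring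
      _ ≤ (CT * (2 * β) * cr * S + ((d : ℝ) + 1) * βT * (2 * β) * cr * S) * Real.exp (-(δm / 2 * tdistT M y y')) := mul_le_mul_of_nonneg_right (add_le_add h1 h2) hE
      _ = (CT + ((d : ℝ) + 1) * βT) * (2 * β) * cr * S * Real.exp (-(δm / 2 * tdistT M y y')) := by ring
  -- (4) the identity and the sum
  have hL2' : 2 ≤ L := hL
  have hid := idef_covLapJet_eq (kingPrV L K n M) (Gt := Gc) (Lp := tensorId (Fin (d + 1)) (kingLapOp L a msq K (L ^ K) M))
    (T := tensorId (Fin (d + 1)) (aK a L K • (Matrix.mulVecLin (blockProj (L ^ K) M) ∘ₗ kingGOp L a msq K (L ^ K) M))) (D := Dc) (c := c) (a := av)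
    (Gt' := Gf) (Lp' := tensorId (Fin (d + 1)) (kingLapOp L a msq (K + n) (L ^ n * L ^ K) M))
    (T' := tensorId (Fin (d + 1)) (aK a L (K + n) • (Matrix.mulVecLin (blockProj (L ^ n * L ^ K) M) ∘ₗ kingGOp L a msq (K + n) (L ^ n * L ^ K) M))) (D' := Df) (c' := c') (a' := a')
    (msq := msq) (tensorId_constraint_eq L M hL2' ha hK hmsq (L ^ K)) (tensorId_constraint_eq L M hL2' ha (by omega) hmsq (L ^ n * L ^ K)) hunit hunit'
  have hsplit : tensorId (Fin (d + 1)) (aK a L (K + n) • (Matrix.mulVecLin (blockProj (L ^ n * L ^ K) M) ∘ₗ kingGOp L a msq (K + n) (L ^ n * L ^ K) M)) ∘ₗ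
        (unstack c' a' ∘ₗ idef (pull (kingPrV L K n M)) (pull (liftPair (J := Fin (d + 1)) (kingPrV L K n M))) (bgPair Gf Df c' a') (bgPair Gc Dc c av) + Wop)
      = (tensorId (Fin (d + 1)) (aK a L (K + n) • (Matrix.mulVecLin (blockProj (L ^ n * L ^ K) M) ∘ₗ kingGOp L a msq (K + n) (L ^ n * L ^ K) M)) ∘ₗ unstack c' a') ∘ₗ
          idef (pull (kingPrV L K n M)) (pull (liftPair (J := Fin (d + 1)) (kingPrV L K n M))) (bgPair Gf Df c' a') (bgPair Gc Dc c av) +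
        tensorId (Fin (d + 1)) (aK a L (K + n) • (Matrix.mulVecLin (blockProj (L ^ n * L ^ K) M) ∘ₗ kingGOp L a msq (K + n) (L ^ n * L ^ K) M)) ∘ₗ Wop := by
    rw [LinearMap.comp_add, LinearMap.comp_assoc]
  rw [hid, hWeq, hsplit]
  refine (((hT1.add hT2).add (hT3.add hT4)).mono fun y y' => ?_)
  have hSE : 0 ≤ S * Real.exp (-(δm / 2 * tdistT M y y')) := mul_nonneg hS (Real.exp_nonneg _)
  have e : m0sq * BJ * S * Real.exp (-(δm / 2 * tdistT M y y')) + (βT + βT * (((d : ℝ) + 2) * (2 * β)) * cr) * S * Real.exp (-(δm / 2 * tdistT M y y')) +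
      (βT * ((d : ℝ) + 2) * BJ * cr * S * Real.exp (-(δm / 2 * tdistT M y y')) + (CT + ((d : ℝ) + 1) * βT) * (2 * β) * cr * S * Real.exp (-(δm / 2 * tdistT M y y')))
      = (B - 1) * (S * Real.exp (-(δm / 2 * tdistT M y y'))) := by rw [hB_def]; ring
  rw [e]
  have e2 : B * S * Real.exp (-(δm / 2 * tdistT M y y')) = (B - 1) * (S * Real.exp (-(δm / 2 * tdistT M y y'))) + S * Real.exp (-(δm / 2 * tdistT M y y')) := by ring
  rw [e2]
  linarith [hSE]

end King

end Summit.QuantumFields.YangMills.BalabanUVNodes.N15.TwoGrid.KingJet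

end
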